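import Summits.BirchSwinnertonDyer.Rank1Residual.ManinAdditive.HesseOptimalityAtThree
import Literature.NumberTheory.EllipticCurves.Gamma1ParametrizationCuspZeroGaloisOrbit
import Literature.NumberTheory.EllipticCurves.ModularSymbolsLattice
import HarnessLib
import HarnessLib.Audit.Tags

/-!
# The Shimura cover has CONSTANT kernel — the `μ`-type node E-an-225 reduced to PRINT + one tree-provable algebra node
(cell `bsd-f2-manin`, lens `an` = periods / optimal-curve & isogeny-class bookkeeping, planner an g41, MEMO-an §86.11;
route `ManinLocalTwoThree`, crux C3 `ManinPrimeToThreeAtNine` = stmt-BirchSwinnertonDyer-22968; proposed target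
`Summits/BirchSwinnertonDyer/Rank1Residual/ManinAdditive/ShimuraCoverMuThree.lean`, `--kind statement --supports stmt-BirchSwinnertonDyer-22968`)

THE POINT.  After prover p2's unconditional sign lemmas (p744182 `threeTorsionSignAtThree_holds`, p744900 `muThreeSignAtThree_holds`)
the only NON-EMPIRICAL open input of the C3 ladder rung «no Shimura `3`-kernel for the optimal curve at `3 ∣ N`, `27 ∤ N`»
(`HesseOptimality.ShimuraThreeKernelForcesTwentySevenOpt`, E-an-222ₒ) is the `μ`-TYPE NODE **E-an-225**
`HesseOptimality.ShimuraThreeKernelHasMuThree` («lattice-optimal `W`, `3 ∣ [Λ₀(f):Λ₁(f)]` ⟹ `μ₃ ⊂ W`»).  Its printed source is ONE sentence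
of Vatsal (2005, Rem. 1.8, verbatim): «we find that `E₁` is the quotient of `E₀` by the subgroup `V₀ = E₀ ∩ V`, for the Shimura subgroup `V`.
… Since the Shimura subgroup is of multiplicative type, we see that there is an isogeny `E₁ → E₀` with kernel equal to a constant group
scheme. We shall refer to `E₁ → E₀` as the Shimura cover.» (multiplicative type of `V`: Ling–Oesterlé 1991, §1).  THIS FILE shows that the
tree ALREADY CONTAINS the constancy of the kernel of the Shimura cover, as a consequence of the registered printed fact
F★ = `optimalGamma1Parametrization_cusp_rational` (CES 2003 §6.1.2/§6.2): analytically the Shimura cover is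
`ℂ/Λ_{E₁} → ℂ/Λ_{E₀}`, `z ↦ (c₀/c₁)·z` (`Λ_{E₁} = c₁Λ₁(f)`, `Λ_{E₀} = c₀Λ₀(f)`), its kernel is `u₁(c₁·Λ₀(f)) ≅ Λ₀(f)/Λ₁(f)`, and EVERY
element of `Λ₀(f)` is a cusp period `{∞,γ∞}_f`, `γ ∈ Γ₀(N)` (`coe_periodLattice_eq_range`), whose image `u₁(c₁{∞,γ∞}_f) = φ₁(γ∞)` is a
RATIONAL point of Stevens' curve `E₁` by F★.  Hence (§1, PROVED, E-an-235): every kernel point of the Shimura cover is `ℚ`-rational; in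
particular a Shimura `p`-kernel puts a rational point of order `p` on Stevens' curve `E₁` (⟸ F★ alone; on the class of a lattice-optimal
minimal `W₀` ⟸ F★ ∧ CES).  What is then LEFT of E-an-225 is pure curve theory over tree theorems — the node **E-an-234**
`ShimuraCoverKernelGivesMuThree` (§2): «an isogeny `E₁ → E₀ = W` given by a lattice homothety, with all kernel points rational and a kernel
point of order `3`, forces a Galois-stable line `M ⊂ W[3]` with trivial quotient character, i.e. `HasShortMuThree W c₀`» — and §3 PROVES
`E-an-225 ⟸ F★ ∧ CES ∧ E-an-234`, §4 the ladder consequence `E-an-222ₒ ⟸ E-an-223 ∧ E-an-234 ∧ {F★₀, F★, F♮, CES}` (all four printed and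
registered; E-an-223 = the cell's empirical Hesse-optimality law, 0/852).

PAPER PROOF OF E-an-234 (for the prover; every tool named is a tree theorem).  Let `ψ : W₁ → W₀` be the `ℚ`-isogeny attached to the
lattice inclusion `(c₀/c₁)·Λ_{W₁} = c₀Λ₁(f) ⊆ c₀Λ₀(f) = Λ_{W₀}` (`exists_isogeny_apply_eq_degree_eq_of_forall_mul_mem_lattice`, analytic
descent).  (i) `ker ψ = u₁(c₁Λ₀(f))` consists of rational points (hypothesis), so `σ` acts trivially on it.  (ii) `W₁[3] ⊄ ker ψ`: otherwise
all of `W₁[3]` is rational and the Weil pairing `e₃` (`exists_weilPairing_holds`) would make `ζ₃` rational.  (iii) The given `x ∈ Λ₀(f)`,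
`3x ∈ Λ₁(f)`, `x ∉ Λ₁(f)` gives `k = u₁(c₁x) ∈ ker ψ ∩ W₁[3]`, `k ≠ O`, so `ker ψ ∩ W₁[3] = ⟨k⟩` with `k` rational.  (iv) In a basis `(k, Q)`
of `W₁[3]`, `ρ̄(σ) = [[1,*],[0,d_σ]]` with `d_σ = det ρ̄(σ) = χ₃(σ)` (Weil pairing), so `M := ψ(W₁[3]) = ⟨ψ(Q)⟩ ⊂ W₀[3]` is a stable line
on which `σ` acts by `χ₃` (`σψ(Q) = ψ(σQ) = d_σ ψ(Q)`), and `W₀[3]/M` has character `det/χ₃ = 1`.  (v) `hasShortMuThree_of_trivialQuotientLine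
W₀ (c₀ ≠ 0) (#M = 3) (M stable) (σT − T ∈ M)` gives `HasShortMuThree W₀ c₀`.  ∎  (p2's `forall_exists_smul_eq_of_hasShortMuThree`, p744900,
is the converse direction of the same dictionary and shows the Galois bookkeeping (i)–(iv) is within reach of the tree.)

HONEST FRAMING.  New definitions: ONE (`ShimuraCoverKernelGivesMuThree`, an OPEN obligation node, paper-provable over tree theorems, NOT a
Literature fact and NOT conjectural in print).  PROVED here (kernel, no sorry, standard axioms): E-an-235 (§1), `E-an-225 ⟸ F★ ∧ CES ∧ E-an-234`
(§3), `E-an-222ₒ ⟸ E-an-223 ∧ E-an-234 ∧ F★₀ ∧ F★ ∧ F♮ ∧ CES` (§4).  C3 (`9 ∣ N ⟹ 3 ∤ c₀`) is NOT proved by this file; E-an-223 stays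
EMPIRICAL; Manin's conjecture and BSD are NOT proved by this.  PARTITION 0 · beyond-print theorem: yes, small (E-an-235: «a Shimura `p`-kernel
forces a rational point of order `p` on the `X₁(N)`-optimal curve», kernel ⟸ F★; in print only as Vatsal's remark for the whole kernel) ·
BSD is not proved by this.
[cite: Vatsal2005, Rem. 1.8 (p. 6–7: «there is an isogeny E₁ → E₀ with kernel equal to a constant group scheme … the Shimura cover») and §1
(V of multiplicative type, [LO91])] [cite: LingOesterle1991, §1, Cor. 1] [cite: Stevens1989, Thm. 1.9 and §2] [cite: ConradEdixhovenStein2003,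
§6.1.2 Lemma 6.1.6, §6.2, Thm. 1.1.3] [cite: Manin1972, Prop. 1.4, Thm. 1.9]

TYPER NOTE (typer g21, T-an-57 — SPLIT BY IMPORT CONE).  SOURCE = HOME/an/g41/ShimuraCoverMuThree-an-g41.lean (FILE K) sha16 2dc0c7cd24ba1a62
(215 l.; an: farm rc 0 · 0 err · 0 warn · 0 sorry, std axioms, audit 2 conjecture + 4 proof.conditional + 3 support; BC7 Probe-bc7-K-g41.lean 2/2
CLEAN 7d5626820646cbfb; MEMO-an §86.11; BC5 e234-an-g41.py 64bd60fa57825f74 → e234-out-an-g41.txt 577b556bb9a23b75: 28/28).  FILE K imports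
`Theorems.ManinLocalTwoThreeCuspZeroAnnihilatorOfCuspGalois`, which lies INSIDE the `Theses.ManinLocalTwoThree` import cone (via
`Theorems.ManinLocalTwoThreeShimuraIndexMuThree`), so — as for T-an-52 — the typer split it: THIS LEAF is route-independent and carries the two
`@[conjecture]` nodes **E-an-235 `ShimuraKernelForcesClassTorsion`** and **E-an-234 `ShimuraCoverKernelGivesMuThree`** VERBATIM plus the cone-free
PROVED `exists_rational_eq_uniformize_of_mem_periodLattice` (E-an-235a ⟸ F★); the SIBLING `ShimuraCoverMuThreeSplit.lean` (imports this leaf +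
the cone module) carries an's other six PROVED theorems VERBATIM (`exists_addOrderOf_eq_of_mem_periodLattice`,
`exists_addOrderOf_eq_of_not_shimuraIndexPrimeTo`, `shimuraKernelForcesClassTorsion_of_cuspRational`, `shimuraThreeKernelHasMuThree_of_cover`,
`shimuraThreeKernelForcesTwentySevenOpt_of_cover`, `plusIndexPrimeToThreeOfNoMuThree_of_cover`).  Leaf imports: landed `…ManinAdditive.HesseOptimalityAtThree`
(p741432) + Literature `Gamma1ParametrizationCuspZeroGaloisOrbit` (p742727) + `ModularSymbolsLattice` + HarnessLib(+Audit.Tags); the two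
`open …Theorems.ManinLocalTwoThree…` lines moved to the sibling; two docstring phrases «PROVED below» → «PROVED in the sibling»; nothing else
changed.  Same namespace `…ManinAdditive.ShimuraCover` in both files.  TURNKEY P-an-g41-1 (p2/p3): `theorem shimuraCoverKernelGivesMuThree_holds`.
`--supports` refused for ManinAdditive ⇒ bears_on: stmt-BirchSwinnertonDyer-22968 (C3 `ManinPrimeToThreeAtNine`).  BSD is not proved by this; C3 OPEN.
-/

set_option autoImplicit false

open scoped Classical MatrixGroups ModularForm
open CongruenceSubgroup WeierstrassCurve Literature.NumberTheory.EllipticCurves Literature.NumberTheory.EllipticCurves.ModularForms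
open Summit.BirchSwinnertonDyer.Rank1Residual.ManinAdditive.KatoCurve
open Summit.BirchSwinnertonDyer.Rank1Residual.ManinAdditive.HesseOptimality

namespace Summit.BirchSwinnertonDyer.Rank1Residual.ManinAdditive.ShimuraCover

/-! ### §1. E-an-235 (PROVED ⟸ F★): the kernel of the Shimura cover is constant — every point `u₁(c₁x)`, `x ∈ Λ₀(f)`, of Stevens'
curve is rational; a Shimura `p`-kernel puts a rational point of order `p` on Stevens' curve -/

section StevensCurve

variable {W₁ : WeierstrassCurve ℚ} [W₁.IsElliptic] {N : ℕ} [NeZero N]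

/-- **Constancy of the kernel of the Shimura cover (E-an-235a, PROVED ⟸ F★).**  For an OPTIMAL `X₁(N)`-datum `D₁` of `W₁`
(`Λ_{W₁} = c₁Λ₁(f)`) and every `Γ₀(N)`-period `x ∈ Λ₀(f)`, the point `u₁(c₁x) ∈ W₁(ℂ)` — a typical point of the kernel
`u₁(c₁Λ₀(f)) ≅ Λ₀(f)/Λ₁(f)` of the Shimura cover `ℂ/Λ_{W₁} → ℂ/c₀Λ₀(f)` — is the base change of a point of `W₁(ℚ)`:
`x = {∞,γ∞}_f` for some `γ ∈ Γ₀(N)` (`coe_periodLattice_eq_range`) and `u₁(c₁{∞,γ∞}_f) = φ₁(γ∞)` is rational (F★).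
[cite: Vatsal2005, Rem. 1.8] [cite: ConradEdixhovenStein2003, §6.1.2 and §6.2] -/
theorem exists_rational_eq_uniformize_of_mem_periodLattice (hF : optimalGamma1Parametrization_cusp_rational)
    (D₁ : Gamma1ParametrizationData W₁ N) (hD₁ : D₁.IsOptimal) {x : ℂ} (hx : x ∈ periodLattice D₁.f) :
    ∃ P : (W₁.baseChange ℚ).toAffine.Point,
      Affine.Point.baseChange (W' := W₁) ℚ ℂ P = D₁.uniformize ((D₁.c : ℂ) * x) := by
  have hx' : x ∈ (periodLattice D₁.f : Set ℂ) := hx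
  rw [coe_periodLattice_eq_range] at hx'
  obtain ⟨γ, rfl⟩ := hx'
  exact hF W₁ D₁ hD₁ γ

-- TYPER (T-an-57 split): `exists_addOrderOf_eq_of_mem_periodLattice`, `exists_addOrderOf_eq_of_not_shimuraIndexPrimeTo` are PROVED in the
-- cone sibling `ShimuraCoverMuThreeSplit.lean` (they use `c_mul_mem_lattice_iff_of_isOptimal`, `gamma1_uniformize_eq_zero_iff` of the
-- `Theses.ManinLocalTwoThree` import cone).

end StevensCurve

section Class

/-- **E-an-235 `ShimuraKernelForcesClassTorsion` (node; PROVED in the sibling `ShimuraCoverMuThreeSplit.lean` ⟸ F★ ∧ CES).**  If `W₀` is globally minimal elliptic with a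
LATTICE-OPTIMAL `X₀(N)`-datum `D₀` and `p ∣ [Λ₀(f):Λ₁(f)]` (`¬ ShimuraIndexPrimeTo p D₀.f`, a Shimura `p`-kernel), then some curve `W₁`
isogenous to `W₀` — Stevens' `X₁(N)`-optimal curve — has a rational point of order `p`.  (All `N`, all reduction types; compare E-an-128ℓ,
the same conclusion ON `W₀`, which needs F★₀ ∧ F♮ as well.) [cite: Vatsal2005, Rem. 1.8] [cite: ConradEdixhovenStein2003, Thm. 1.1.3, §6.2]
[conjecture — obligation node, OPEN unconditionally in the tree; PROVED in the sibling `ShimuraCoverMuThreeSplit.lean` modulo the registered printed facts F★ ∧ CES] -/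
@[conjecture]
def ShimuraKernelForcesClassTorsion : Prop :=
  ∀ (W₀ : WeierstrassCurve ℚ) [W₀.IsElliptic] [W₀.IsGloballyMinimal] {N : ℕ} [NeZero N]
    (D₀ : ModularParametrizationData W₀ N),
    (∀ z ∈ D₀.L.lattice, ∃ w ∈ periodLattice D₀.f, z = D₀.c * w) → ∀ {p : ℕ}, p.Prime → ¬ ShimuraIndexPrimeTo p D₀.f →
    ∃ (W₁ : WeierstrassCurve ℚ) (_ : W₁.IsElliptic), IsIsogenous W₁ W₀ ∧
      ∃ P : (W₁.baseChange ℚ).toAffine.Point, addOrderOf P = p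

-- TYPER (T-an-57 split): `shimuraKernelForcesClassTorsion_of_cuspRational` (E-an-235 ⟸ F★ ∧ CES) is PROVED in the cone sibling.

end Class

/-! ### §2. E-an-234 — the algebra node: a constant-kernel cover with a kernel point of order `3` forces `μ₃ ⊂ W₀` -/

/-- **E-an-234 `ShimuraCoverKernelGivesMuThree` (OPEN in the tree; a THEOREM on paper over tree tools — see the module docstring, steps
(i)–(v)).**  Data: `W₀` globally minimal elliptic with a LATTICE-OPTIMAL `X₀(N)`-datum `D₀` (`Λ_{W₀} = c₀Λ₀(f)`), `W₁` globally minimal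
elliptic with an OPTIMAL `X₁(N)`-datum `D₁` (`Λ_{W₁} = c₁Λ₁(f)`) of the SAME newform `f`; hypotheses: every point `u₁(c₁x)`, `x ∈ Λ₀(f)`,
of `W₁(ℂ)` (= every kernel point of the Shimura cover `ℂ/Λ_{W₁} → ℂ/Λ_{W₀}`, `z ↦ (c₀/c₁)z`) is rational, and a kernel point
`u₁(c₁x)`, `x ∈ Λ₀(f)`, `3x ∈ Λ₁(f)`, under a RATIONAL point `P` of order `3` — BOTH DISCHARGED by §1 from F★.  Conclusion: `HasShortMuThree W₀ c₀` (`μ₃ ↪ W₀[3]` in the cell's short-model costume).  Proof on paper: analytic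
descent (`exists_isogeny_apply_eq_degree_eq_of_forall_mul_mem_lattice`), Weil pairing (`exists_weilPairing_holds`), and the dictionary
`hasShortMuThree_of_trivialQuotientLine`.  No Literature fact is needed.
[cite: Vatsal2005, Rem. 1.8] [cite: LingOesterle1991, §1, Cor. 1] [cite: SilvermanAEC2009, III.8 (Weil pairing)]
[conjecture — OPEN obligation node, paper-provable over tree theorems; NOT a Literature fact] -/
@[conjecture]
def ShimuraCoverKernelGivesMuThree : Prop :=
  ∀ (W₀ W₁ : WeierstrassCurve ℚ) [W₀.IsElliptic] [W₀.IsGloballyMinimal] [W₁.IsElliptic] [W₁.IsGloballyMinimal]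
    {N : ℕ} [NeZero N] (D₀ : ModularParametrizationData W₀ N) (D₁ : Gamma1ParametrizationData W₁ N),
    D₁.f = D₀.f →
    (∀ z ∈ D₀.L.lattice, ∃ w ∈ periodLattice D₀.f, z = D₀.c * w) → D₁.IsOptimal →
    (∀ x ∈ periodLattice D₀.f, ∃ P : (W₁.baseChange ℚ).toAffine.Point,
      Affine.Point.baseChange (W' := W₁) ℚ ℂ P = D₁.uniformize ((D₁.c : ℂ) * x)) →
    ∀ (x : ℂ) (P : (W₁.baseChange ℚ).toAffine.Point), x ∈ periodLattice D₀.f → (3 : ℂ) * x ∈ periodLatticeGamma1 D₀.f →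
      Affine.Point.baseChange (W' := W₁) ℚ ℂ P = D₁.uniformize ((D₁.c : ℂ) * x) → addOrderOf P = 3 →
      HasShortMuThree W₀ D₀.c

-- TYPER (T-an-57 split): §3 `shimuraThreeKernelHasMuThree_of_cover` (E-an-225 ⟸ F★ ∧ CES ∧ E-an-234) and §4
-- `shimuraThreeKernelForcesTwentySevenOpt_of_cover`, `plusIndexPrimeToThreeOfNoMuThree_of_cover` are PROVED in the cone sibling
-- `ShimuraCoverMuThreeSplit.lean`.

end Summit.BirchSwinnertonDyer.Rank1Residual.ManinAdditive.ShimuraCover
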